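import Summits.CriticalPhenomena.PercolationContinuityZ3.Theorems.PercNearOneGluingNoHeavyQuantLawDecAbsorb
import HarnessLib

/-!
# QUANT lane R8, T-DEC: law-level DEC(j′) criteria, part B — CRITERION C′: giant absorption plus Theorem A on the remainder
# under a MEAN CONDITION

builds on p205010 (kernel theorem, internal audit signed; external expert review pending)

Support file (`--supports stmt-CriticalPhenomena-4575`), QUANT lane seat prim-quant-census-2 (gen 52), rung R8 of
`run/shared/lean/prim/quant/LADDER.md`; continues `…QuantLawDecAbsorb` (CORE `LawDec.decAt_of_absorb`, criterion E).  Memo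
`run/shared/lean/prim/quant/prim-quant-census-2-g52/DEC-CRITERIA-G52.md`.  Theorems only (no definitions), standard axioms.

* `LawDec.rest_of_meanCondition` — the remainder datum of the CORE from a MEAN CONDITION.  Let `ν ≥ 0` on `{0..j′}` have its charged
  atoms in `[ℓ*, h*]` and first moment `≥ (T − σ)·mass(ν)` where `σ ≤ ℓ*`, `σ ≤ ℓ*(1−x)² + x(T − x·h*)`, `x < 1`.
  Lemma P (`exists_twoPoint_decomposition`, DEC-TAMP-G50 §1) writes the normalised `ν` as a mixture of two-point laws, each
  mean-exact at `m ≥ T − σ` with charged atoms; every one is valid at `(x, T, j′)`: a point mass sits at `m ≥ ℓ* ≥ σ`, so `2m ≥ T` (rule (S)); a heavy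
  pair `{lo, hi; g ≥ x}` has credit `2lo + (hi−lo)g = lo + m ≥ ℓ* + T − σ ≥ T`; a light pair (`g < x`) has discounted credit
  `2lo + (m − lo − (hi−lo)x²)/(1−x) ≥ T ⟺ T − m ≤ lo(1−x)² + x(T − x·hi)`, implied by the third bound on `σ` (rule (N)).
* **`LawDec.decAt_of_absorb_meanCondition` — CRITERION C′.**  Law `μ` on `{0..M}` (mean `T`), floor `0 < x < 1`, layer `j′ < M`,
  absorbed masses `0 ≤ f ≤ μ` on `{0..j′}` with `x·Σ f = (1−x)·P(giant)` (the giants take exactly `f` at gate `x`), and the mean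
  condition above for the remainder `μ − f` ⟹ `Quant.LawDec.DECAt x j′ M μ`.  With `f` = "the smallest atoms first" this certifies,
  together with criterion E, DEC(j′) for all but a thin high-floor family of heavy blob systems (census in the memo, exact rationals).

[this work]; DEC rules ARCH-TREES-G49 §2.2 / DEC-TAMP-G50 §3.1, Theorem A / Lemma P DEC-TAMP-G50 §1 (this lane).  The gluing rows
served [cite: KozmaNitzan2024, Conjecture 3 (p. 15)]; product measure [cite: Grimmett1999, §1.3 p. 10].
-/

noncomputable section

namespace Summit.CriticalPhenomena.PercolationContinuityZ3.Theorems

namespace Quant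

open Finset

/-- the two-point law `{lo, hi; g}` (as in `…QuantLawDEC`) -/
local notation3 "TP[" lo ", " hi ", " g ", " h "]" =>
  (g : ℝ) * (if (h : ℕ) = (hi : ℕ) then (1 : ℝ) else 0) + (1 - (g : ℝ)) * (if (h : ℕ) = (lo : ℕ) then (1 : ℝ) else 0)

namespace LawDec

/-- **Remainder data from a MEAN CONDITION (Theorem A on the remainder).**  See the file header: the normalised remainder's Lemma-P
decomposition is mean-exact at `m ≥ T − σ`, and the two bounds on `σ` make every point mass, heavy pair and light pair valid at
`(x, T, j′)`. [this work] -/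
theorem rest_of_meanCondition (x T σ : ℝ) (j' lstar hstar : ℕ) (ν : ℕ → ℝ) (hν0 : ∀ h, 0 ≤ ν h) (hx1 : x < 1)
    (hl : ∀ h, h ≤ j' → 0 < ν h → lstar ≤ h) (hh : ∀ h, h ≤ j' → 0 < ν h → h ≤ hstar)
    (hσl : σ ≤ lstar) (hσ2 : σ ≤ (lstar : ℝ) * (1 - x) ^ 2 + x * (T - x * hstar))
    (hmean : (T - σ) * ∑ h ∈ Finset.range (j' + 1), ν h ≤ ∑ h ∈ Finset.range (j' + 1), (h : ℝ) * ν h) :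
    ∃ (ρ : Type) (_ : Fintype ρ) (lam g : ρ → ℝ) (lo hi : ρ → ℕ),
      (∀ r, 0 ≤ lam r) ∧ (∑ r, lam r = ∑ h ∈ Finset.range (j' + 1), ν h) ∧ (∀ r, 0 ≤ g r ∧ g r ≤ 1) ∧
      (∀ r, lo r ≤ hi r) ∧ (∀ r, hi r ≤ j') ∧
      (∀ h, (if h ≤ j' then ν h else 0) = ∑ r, lam r * TP[lo r, hi r, g r, h]) ∧
      (∀ r, 0 < lam r → ValidAt x T j' (lo r) (hi r) (g r)) := by
  classical
  obtain ⟨m, hm⟩ : ∃ m : ℝ, m = ∑ h ∈ Finset.range (j' + 1), ν h := ⟨_, rfl⟩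
  have hm0 : 0 ≤ m := by rw [hm]; exact Finset.sum_nonneg fun h _ => hν0 h
  rw [← hm] at hmean ⊢
  rcases hm0.eq_or_lt with hm0' | hmpos
  · -- empty remainder
    have hz : ∀ h, h ≤ j' → ν h = 0 := fun h hh =>
      (Finset.sum_eq_zero_iff_of_nonneg (fun k _ => hν0 k)).1 (hm ▸ hm0'.symm) h
        (Finset.mem_range.2 (Nat.lt_succ_of_le hh))
    refine ⟨Fin 1, inferInstance, fun _ => 0, fun _ => 0, fun _ => 0, fun _ => 0, fun _ => le_rfl, ?_,
      fun _ => ⟨le_rfl, zero_le_one⟩, fun _ => le_rfl, fun _ => Nat.zero_le _, fun h => ?_,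
      fun _ h0 => absurd h0 (lt_irrefl 0)⟩
    · rw [← hm0']; simp
    · have : (if h ≤ j' then ν h else 0) = 0 := by
        split_ifs with hh
        · exact hz h hh
        · rfl
      rw [this]; simp
  · -- normalise and apply Lemma P
    have hmne : m ≠ 0 := hmpos.ne'
    obtain ⟨νn, hνn⟩ : ∃ νn : ℕ → ℝ, νn = fun h => (if h ≤ j' then ν h else 0) / m := ⟨_, rfl⟩
    have hνn_apply : ∀ h, νn h = (if h ≤ j' then ν h else 0) / m := fun h => by rw [hνn]
    have hn0 : ∀ h, 0 ≤ νn h := fun h => by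
      rw [hνn_apply]; refine div_nonneg ?_ hm0; split_ifs <;> [exact hν0 h; exact le_rfl]
    have hnM : ∀ h, j' < h → νn h = 0 := fun h hh => by rw [hνn_apply, if_neg (not_le.2 hh), zero_div]
    have hle : ∀ h, h ∈ Finset.range (j' + 1) → (if h ≤ j' then ν h else 0) = ν h := fun h hh => by
      rw [if_pos (Nat.lt_succ_iff.1 (Finset.mem_range.1 hh))]
    have hn1 : ∑ h ∈ Finset.range (j' + 1), νn h = 1 := by
      simp_rw [hνn_apply]
      rw [← Finset.sum_div, Finset.sum_congr rfl hle, ← hm, div_self hmne]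
    have hmeanN : ∑ h ∈ Finset.range (j' + 1), (h : ℝ) * νn h = (∑ h ∈ Finset.range (j' + 1), (h : ℝ) * ν h) / m := by
      rw [eq_div_iff hmne, Finset.sum_mul]
      refine Finset.sum_congr rfl fun h hh => ?_
      rw [hνn_apply, hle h hh]
      field_simp
    obtain ⟨lam, g, lo, hi, h0, h1, hg, hlohi, hhi, hmix, hgen⟩ :=
      exists_twoPoint_decomposition j' j' le_rfl νn hn0 hnM hn1
    have hmT : T - σ ≤ ∑ h ∈ Finset.range (j' + 1), (h : ℝ) * νn h := by
      rw [hmeanN, le_div_iff₀ hmpos]; exact hmean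
    have charged : ∀ k, 0 < νn k → k ≤ j' ∧ 0 < ν k := by
      intro k hk
      rw [hνn_apply] at hk
      by_cases hk' : k ≤ j'
      · rw [if_pos hk'] at hk
        exact ⟨hk', (div_pos_iff_of_pos_right hmpos).1 hk⟩
      · rw [if_neg hk', zero_div] at hk
        exact absurd hk (lt_irrefl 0)
    refine ⟨Fin (j' + 1) × Fin (j' + 1), inferInstance, fun r => m * lam r, g, lo, hi,
      fun r => mul_nonneg hm0 (h0 r), ?_, hg, hlohi, hhi, fun h => ?_, fun r hr => ?_⟩
    · rw [← Finset.mul_sum, h1, mul_one]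
    · have e : (if h ≤ j' then ν h else 0) = m * νn h := by
        rw [hνn_apply]; exact (mul_div_cancel₀ _ hmne).symm
      rw [e, hmix h, Finset.mul_sum]
      refine Finset.sum_congr rfl fun r _ => ?_
      ring
    · have hlam : 0 < lam r := pos_of_mul_pos_right hr hm0
      obtain ⟨hclo, hchi, hmeanr, -⟩ := hgen r hlam
      have hlo_ge : (lstar : ℝ) ≤ lo r := by exact_mod_cast hl _ (charged _ hclo).1 (charged _ hclo).2
      have hhi_le : (hi r : ℝ) ≤ hstar := by exact_mod_cast hh _ (charged _ hchi).1 (charged _ hchi).2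
      rcases Nat.eq_or_lt_of_le (hlohi r) with heq | hlt
      · -- point mass at `m ≥ T − σ ≥ T/2`
        refine Or.inl ⟨heq, Or.inl ?_⟩
        have : (lo r : ℝ) = ∑ h ∈ Finset.range (j' + 1), (h : ℝ) * νn h := by
          rw [← hmeanr, ← heq]; ring
        linarith
      · refine Or.inr (Or.inr ⟨hlt, hhi r, ?_⟩)
        split_ifs with hxg
        · -- heavy pair: credit `lo + m`
          linarith
        · -- light pair: discounted credit
          have h1x : 0 < 1 - x := by linarith
          have key : T * (1 - x) ≤ 2 * (lo r : ℝ) * (1 - x) + ((hi r : ℝ) - lo r) * (g r - x ^ 2) := by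
            have p1 : 0 ≤ ((lo r : ℝ) - lstar) * (1 - x) ^ 2 := mul_nonneg (sub_nonneg.2 hlo_ge) (sq_nonneg _)
            have p2 : 0 ≤ ((hstar : ℝ) - hi r) * x ^ 2 := mul_nonneg (sub_nonneg.2 hhi_le) (sq_nonneg _)
            nlinarith [hmeanr, hmT, hσ2, p1, p2]
          have e2 : 2 * (lo r : ℝ) + ((hi r : ℝ) - lo r) * ((g r - x ^ 2) / (1 - x))
              = (2 * (lo r : ℝ) * (1 - x) + ((hi r : ℝ) - lo r) * (g r - x ^ 2)) / (1 - x) := by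
            field_simp
          rw [e2, le_div_iff₀ h1x]
          exact key

/-- **CRITERION C′ (giant absorption at the floor gate + Theorem A on the remainder).**  Law `μ` on `{0..M}` with mean `T`, floor
`0 < x < 1`, layer `j′ < M`; absorbed masses `0 ≤ f ≤ μ` on `{0..j′}` balancing the giants at gate `x` (`x·Σ_{h ≤ j′} f h =
(1−x)·Σ_{j′ < h ≤ M} μ h`); the remainder `μ − f` (on `{0..j′}`) has its charged atoms in `[ℓ*, h*]` and first moment
`≥ (T − σ)·mass` with `σ ≤ ℓ*`, `σ ≤ ℓ*(1−x)² + x(T − x·h*)`.  Then `Quant.LawDec.DECAt x j′ M μ`. [this work] -/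
theorem decAt_of_absorb_meanCondition (x σ : ℝ) (j' M lstar hstar : ℕ) (μ f : ℕ → ℝ) (hjM : j' < M)
    (hμ0 : ∀ h, 0 ≤ μ h) (hμM : ∀ h, M < h → μ h = 0) (hμ1 : ∑ h ∈ Finset.range (M + 1), μ h = 1)
    (hx0 : 0 < x) (hx1 : x < 1) (hf0 : ∀ h, 0 ≤ f h) (hfμ : ∀ h, f h ≤ μ h)
    (hbal : x * ∑ h ∈ Finset.range (j' + 1), f h = (1 - x) * ∑ h ∈ Finset.Ico (j' + 1) (M + 1), μ h)
    (hl : ∀ h, h ≤ j' → f h < μ h → lstar ≤ h) (hh : ∀ h, h ≤ j' → f h < μ h → h ≤ hstar)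
    (hσl : σ ≤ lstar)
    (hσ2 : σ ≤ (lstar : ℝ) * (1 - x) ^ 2 + x * ((∑ k ∈ Finset.range (M + 1), (k : ℝ) * μ k) - x * hstar))
    (hmean : ((∑ k ∈ Finset.range (M + 1), (k : ℝ) * μ k) - σ) * ∑ h ∈ Finset.range (j' + 1), (μ h - f h)
      ≤ ∑ h ∈ Finset.range (j' + 1), (h : ℝ) * (μ h - f h)) :
    DECAt x j' M μ :=
  decAt_of_absorb x x j' M μ f hjM hμ0 hμM hμ1 le_rfl hx0 hx1 hf0 hbal
    (rest_of_meanCondition x _ σ j' lstar hstar (fun h => μ h - f h) (fun h => sub_nonneg.2 (hfμ h)) hx1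
      (fun h h1 hp => hl h h1 (sub_pos.1 hp)) (fun h h1 hp => hh h h1 (sub_pos.1 hp)) hσl hσ2 hmean)

end LawDec

end Quant

end Summit.CriticalPhenomena.PercolationContinuityZ3.Theorems
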